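import Summits.HodgeConjecture.HodgeConjecture.Theorems.R90S3PlantedDyadicData   -- ★ P8d (this seat): §2 `exists_planted_dyadic_data` (+ ★ P8c `isUnramifiedAt_of_planted` by import)
import HarnessLib

/-!
# R90-TF · S3 · THEOREMS — `R90S3PlantedUnramifiedAwayTwo` ((U3-F) split, p = 2 pass, «UR₂-PACKAGE»): with the planted place `v′` DYADIC, «`α` a unit off `v′`» and
# «`α ≡ 1 (mod 4)` at the dyadic places `u ≠ v′`» give the socket's `hur′` clause — `E = F(√α)` is unramified at every place over every finite `u ≠ v′`

R90-TF section S3 (dealer R90-C12-plan (g3), deal S3-p21‴ 2026-09-05T01:48:10Z (6), head bytes of record; census memo `R90/S3/CENSUS-U3F-p2.K2E3-p21-g9.md` C4); crux H413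
(`stmt-HodgeConjecture-24833`, lane `--supports … --as helper`), route `HCCMUnconditional`.  The `p = 2` twin of ★ P8d §1 `isUnramifiedAt_of_planted_of_dyadic`: there the planted
prime was odd and `α ≡ 1 (mod 4)` held at EVERY dyadic place (global `κ`); here `v′` is itself dyadic, nothing is assumed at `v′`, and the auxiliary `ξ, x, m₁ = α ξ²` of ★ P8d §2
`exists_planted_dyadic_data` (the C5 ξ-trick, CRT) feed the `x`-version of ★ P8c `isUnramifiedAt_of_planted`.  Consumed by the `p = 2` branch of the FINAL `plantedDenseCM`
(captain K2E3-p17) after ★ B7∕C3 deliver `hαu` (all `u ≠ v′`: ★ P5 off `2`, the pinned `U_i`) and `hα4` (C3 `R90S3PlantedDyadicPlacesTwo`, K2E3-p36).  THEOREMS ONLY (no `def`,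
no `instance`, no notation, no named fact, no `sorry`); ★ imports only; never imports `Cruxes/…/Lines`.

THE MATHEMATICS [Neukirch1999 Ch. III §2 Thm. (2.6); Omeara1963 §63A, §65A].  `E ∕ F` quadratic, `δ² = α ∈ 𝓞 F`, `δ ∉ F`, `v′` a finite place.  If `α ∉ 𝔭_u` for every
`u ≠ v′` and `|(α − 1)∕4|_u ≤ 1` at every dyadic `u ≠ v′`, then (★ P8d §2) there are `ξ ≠ 0`, `x`, `m₁ = α ξ²` with `x² − m₁ ∈ (4)` and `m₁ ∉ 𝔭_u` at the dyadic `u ≠ v′`;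
★ P8c: at odd `u ≠ v′` the different contains `2δ` (unit radicand), at dyadic `u ≠ v′` it contains `2θ − x = δξ` with `θ = (x + δξ)∕2` integral — unramified in both cases.
* **`forall_ne_isUnramifiedAt_of_planted_two`** (dealer's bytes), `forall_ne_isUnramifiedIn_of_planted_two`, **`forall_ne_isUnramifiedAt_of_planted_two_cm`** (`F := L′⁺`,
  `E := L′`; conclusion = socket :675 token for token).

HONEST LABEL: HC_CM is proved only modulo the 7 printed citations (2 remaining named inputs: hLiu418 = stmt-HodgeConjecture-24832, h413 =
stmt-HodgeConjecture-24833) until rung 0 closes; glue toward the GENUINE residual (U3-F), p = 2 branch; proves nothing printed; count-neutral.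

## References
* [Neukirch1999] J. Neukirch, *Algebraic Number Theory* (1999), Ch. III §2 Thm. (2.6).
* [Omeara1963] O. T. O'Meara, *Introduction to Quadratic Forms* (1963), §63A, §65A.
-/

set_option autoImplicit false
-- the mandated namespace repeats the single-problem summit's segment (`HodgeConjecture.HodgeConjecture`)
set_option linter.dupNamespace false

noncomputable section

namespace Summit.HodgeConjecture.HodgeConjecture.R90.S3

open NumberField IsDedekindDomain
open Literature.NumberTheory.NumberFields Literature.NumberTheory.Automorphic Literature.NumberTheory.Automorphic.UnitaryGroup

section General

variable {F : Type} (E : Type) [Field F] [NumberField F] [Field E] [NumberField E] [Algebra F E] [Algebra.IsQuadraticExtension F E]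

/-- **UR₂ — the `hur′` clause with the planted place `v′` DYADIC.**  `δ² = α ∈ 𝓞 F`, `δ ∉ F`; if `α ∉ 𝔭_u` for every finite `u ≠ v′` and `|(α − 1)∕4|_u ≤ 1` at every dyadic
`u ≠ v′`, then `E` is unramified at every place over every finite `u ≠ v′` (★ P8d §2 `exists_planted_dyadic_data` ∘ ★ P8c `isUnramifiedAt_of_planted`; nothing is assumed at
`v′`). Dealer's head bytes (01:48:10Z (6)). [cite: Neukirch1999, Ch. III §2 Thm. (2.6)] [cite: Omeara1963, §63A, §65A] -/
theorem forall_ne_isUnramifiedAt_of_planted_two (v' : HeightOneSpectrum (𝓞 F)) {δ : E} (α : 𝓞 F) (hδ : δ ^ 2 = algebraMap F E (α : F))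
    (hδF : δ ∉ (algebraMap F E).range) (hαu : ∀ u : HeightOneSpectrum (𝓞 F), u ≠ v' → α ∉ u.asIdeal)
    (hα4 : ∀ u : HeightOneSpectrum (𝓞 F), u ≠ v' → (2 : 𝓞 F) ∈ u.asIdeal → u.valuation F ((((α : F)) - 1) / 4) ≤ 1) :
    ∀ u : HeightOneSpectrum (𝓞 F), u ≠ v' → ∀ W : PlacesOver E u, Algebra.IsUnramifiedAt (𝓞 F) W.1.asIdeal := by
  obtain ⟨x, m₁, ξ, hξ, hm₁, hx, hm₁u⟩ := exists_planted_dyadic_data v' α (fun u hu _ => hαu u hu) hα4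
  exact isUnramifiedAt_of_planted E v' α hδ hδF (fun u hu _ => hαu u hu) x m₁ ξ hξ hm₁ hx hm₁u

/-- `Algebra.IsUnramifiedIn` form of `forall_ne_isUnramifiedAt_of_planted_two`. [cite: Neukirch1999, Ch. III §2 Thm. (2.6)] -/
theorem forall_ne_isUnramifiedIn_of_planted_two (v' : HeightOneSpectrum (𝓞 F)) {δ : E} (α : 𝓞 F) (hδ : δ ^ 2 = algebraMap F E (α : F))
    (hδF : δ ∉ (algebraMap F E).range) (hαu : ∀ u : HeightOneSpectrum (𝓞 F), u ≠ v' → α ∉ u.asIdeal)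
    (hα4 : ∀ u : HeightOneSpectrum (𝓞 F), u ≠ v' → (2 : 𝓞 F) ∈ u.asIdeal → u.valuation F ((((α : F)) - 1) / 4) ≤ 1) :
    ∀ u : HeightOneSpectrum (𝓞 F), u ≠ v' → Algebra.IsUnramifiedIn (𝓞 E) u.asIdeal := by
  intro u hu P hP hlo
  have hPbot : P ≠ ⊥ := Ideal.ne_bot_of_liesOver_of_ne_bot u.ne_bot P
  exact forall_ne_isUnramifiedAt_of_planted_two E v' α hδ hδF hαu hα4 u hu ⟨⟨P, hP, hPbot⟩, HeightOneSpectrum.ext hlo.over.symm⟩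

end General

/-- **UR₂, CM SPELLING** (`F := L′⁺`, `E := L′`): the socket's clause `∀ w′ ≠ v′, ∀ W : PlacesOver L′ w′, Algebra.IsUnramifiedAt (𝓞 L′⁺) W.1.asIdeal` (G :675 bytes) for a CM
field `L′ = L′⁺(δ)`, `δ² = α`, the planted place `v′` dyadic, from «`α ∉ 𝔭_u` for all `u ≠ v′`» and «`|(α − 1)∕4|_u ≤ 1` at dyadic `u ≠ v′`». [cite: Neukirch1999, Ch. III §2 Thm. (2.6)] -/
theorem forall_ne_isUnramifiedAt_of_planted_two_cm (L' : Type) [Field L'] [NumberField L'] [IsCMField L']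
    (v' : HeightOneSpectrum (𝓞 ↥(maximalRealSubfield L'))) {δ : L'} (α : 𝓞 ↥(maximalRealSubfield L'))
    (hδ : δ ^ 2 = algebraMap ↥(maximalRealSubfield L') L' (α : ↥(maximalRealSubfield L')))
    (hδF : δ ∉ (algebraMap ↥(maximalRealSubfield L') L').range)
    (hαu : ∀ u : HeightOneSpectrum (𝓞 ↥(maximalRealSubfield L')), u ≠ v' → α ∉ u.asIdeal)
    (hα4 : ∀ u : HeightOneSpectrum (𝓞 ↥(maximalRealSubfield L')), u ≠ v' → (2 : 𝓞 ↥(maximalRealSubfield L')) ∈ u.asIdeal →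
      u.valuation ↥(maximalRealSubfield L') ((((α : ↥(maximalRealSubfield L'))) - 1) / 4) ≤ 1) :
    ∀ w' : HeightOneSpectrum (𝓞 ↥(maximalRealSubfield L')), w' ≠ v' → ∀ W : UnitaryGroup.PlacesOver L' w',
      Algebra.IsUnramifiedAt (𝓞 ↥(maximalRealSubfield L')) W.1.asIdeal :=
  forall_ne_isUnramifiedAt_of_planted_two L' v' α hδ hδF hαu hα4

end Summit.HodgeConjecture.HodgeConjecture.R90.S3

end
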